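import Summits.AtomisticToContinuum.HydrodynamicLimit.Theorems.StiffCollisionalRelaxationAprioriBoundsFibreDefs
import HarnessLib

/-!
# The linear statistic of the line `fibre-deficit-transfer` as five empirical field deviations; convergence in probability
along the flow from the hydrodynamic limit at a fixed time (skeleton r4, stub `stub_linStatL1`, part 1; crux `AprioriBounds`,
stmt-AtomisticToContinuum-14827)

Support file (`--supports stmt-AtomisticToContinuum-14827`) of the stub-worker of `stub_linStatL1` (the OPEN, conjunct-strength
dynamical input `LinStatL1VanishAt` of the rate-free (i)-chain).  Part 1 of the glue `linStatL1_of_hydroLimitOn`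
(`…FibreLinStatL1Glue`): the ALGEBRA and the fixed-time probability estimate.

* `LinStatL1.tiltExponent_eq_fields`: `Λ(s,x)·(1,v,|v|²/2) = λ₀(s,x) + ∑ₗ (uₗ/θ)(s,x)·vₗ + (−1/θ(s,x))·|v|²/2`, so the empirical
  average of the tilt exponent is the density field tested with `χ_ρ = λ₀(s,·)`, plus the `l`-th coordinates of the momentum fields
  tested with `χₗ = uₗ(s,·)/θ(s,·)`, plus the energy field tested with `χ_E = −1/θ(s,·)` (`avg_tiltExponent_eq_fields`), and the Euler
  mean is `m_s = ∫χ_ρρ + ∑ₗ (∫(χₗρ)•u)ₗ + ∫χ_E E`, `E = ρ(|u|²/2 + 3θ/2)` (`tiltMean_eq_fields`); hence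
  `|ℓ_s| ≤ |dev_ρ| + ∑ₗ ‖devₗ‖ + |dev_E|` (`abs_linStat_le_fields`).
* `tendsto_measure_linStat_flow_of_hydroFieldsAt` (registered sub-goal): with the five test functions continuous (slice fields
  continuous, `θ > 0`, continuous density multiplier), `TendstoHydroFieldsAt … s` gives `P_N{δ < |ℓ_s ∘ Φ_s|} → 0` for every `δ > 0`;
  the rated input `LinearHydroRateAt` of skeleton r2 gives the same (`tendsto_measure_lt_abs_linStat_flow_of_rate`).
* `LinStatL1.abs_linStat_flow_le_split`: the pointwise exponential-Markov split of `|ℓ_s ∘ Φ_s|` used by part 2 (copied from the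
  lead's `…FibreDeficitMeanBound`, which is not yet in the tree).

No new definitions, no named facts; axioms `propext`, `Classical.choice`, `Quot.sound`.
-/

noncomputable section

open MeasureTheory Filter Set Topology
open scoped ENNReal

namespace Summit.AtomisticToContinuum.HydrodynamicLimit.Theorems.FibreDeficitTransfer

open Literature.MathematicalPhysics.KineticTheory Literature.Analysis.FluidPDE
open Summit.AtomisticToContinuum.HydrodynamicLimit.Theorems.AprioriBoundsNegative (PartOneAt PartTwoAt)
open Summit.AtomisticToContinuum.HydrodynamicLimit.Theorems.VisitLedgerUpscattering (Cfg Flow Flows NiceProfiles)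

namespace LinStatL1

variable {σ : ℝ} {ρ θ : ℝ → T3 → ℝ} {u : ℝ → T3 → V3} {t : ℝ}

/-! ## Slice regularity -/

/-- The tilt exponent of a slice with continuous fields, `θ > 0` and a continuous density multiplier is continuous in
`y = (x, v)`. -/
theorem continuous_tiltExponent_slice (s : ℝ) (hθc : Continuous (θ s)) (huc : Continuous (u s))
    (hθ : ∀ x, 0 < θ s x) (hΛ : Continuous fun x => lam0 σ (ρ s x) (θ s x) (u s x)) :
    Continuous fun y : T3 × V3 => tiltExponent σ ρ θ u s y := by
  unfold tiltExponent
  exact ((hΛ.comp continuous_fst).add (((huc.comp continuous_fst).inner continuous_snd).div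
    (hθc.comp continuous_fst) fun y => (hθ y.1).ne')).sub ((continuous_snd.norm.pow 2).div
    (continuous_const.mul (hθc.comp continuous_fst)) fun y => mul_ne_zero two_ne_zero (hθ y.1).ne')

/-- The linear statistic of such a slice is measurable in the configuration. -/
theorem measurable_linStat_slice (s : ℝ) (hθc : Continuous (θ s)) (huc : Continuous (u s))
    (hθ : ∀ x, 0 < θ s x) (hΛ : Continuous fun x => lam0 σ (ρ s x) (θ s x) (u s x)) (N : ℕ) :
    Measurable fun w : Cfg N => linStat σ ρ θ u s w := by
  have h : (fun w : Cfg N => linStat σ ρ θ u s w) =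
      fun w => ((N + 1 : ℕ) : ℝ)⁻¹ * (∑ i, tiltExponent σ ρ θ u s (w i)) - tiltMean σ ρ θ u s := by
    funext w; rw [linStat_eq, tiltPot]
  rw [h]
  refine (measurable_const.mul (Finset.measurable_sum _ fun i _ => ?_)).sub measurable_const
  exact (continuous_tiltExponent_slice s hθc huc hθ hΛ).measurable.comp (measurable_pi_apply i)

/-! ## The linear statistic in terms of the five empirical field deviations -/

/-- The one-particle tilt exponent in terms of the five scalar test fields `λ₀`, `uₗ/θ`, `−1/θ`:
`Λ·(1, v, |v|²/2) = λ₀(x) + ∑ₗ (uₗ(x)/θ(x))·vₗ + (−θ(x)⁻¹)·(|v|²/2)`. -/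
theorem tiltExponent_eq_fields (s : ℝ) (y : T3 × V3) :
    tiltExponent σ ρ θ u s y = lam0 σ (ρ s y.1) (θ s y.1) (u s y.1) +
      ∑ l, u s y.1 l / θ s y.1 * y.2 l + -(θ s y.1)⁻¹ * (‖y.2‖ ^ 2 / 2) := by
  rw [tiltExponent]
  have hin : inner ℝ (u s y.1) y.2 = ∑ l, u s y.1 l * y.2 l := by
    simp only [PiLp.inner_apply, RCLike.inner_apply, conj_trivial]
    exact Finset.sum_congr rfl fun l _ => mul_comm _ _
  have hsum : ∑ l, u s y.1 l / θ s y.1 * y.2 l = (∑ l, u s y.1 l * y.2 l) / θ s y.1 := by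
    rw [Finset.sum_div]
    exact Finset.sum_congr rfl fun l _ => by ring
  rw [hin, hsum]
  ring

/-- The empirical average of the tilt exponent: the density field tested with `λ₀(s,·)`, plus the `l`-th coordinates of the
momentum fields tested with `uₗ(s,·)/θ(s,·)`, plus the energy field tested with `−1/θ(s,·)`. -/
theorem avg_tiltExponent_eq_fields (s : ℝ) {N : ℕ} (w : Cfg N) :
    ((N + 1 : ℕ) : ℝ)⁻¹ * ∑ i, tiltExponent σ ρ θ u s (w i) =
      empiricalDensityField w (fun x => lam0 σ (ρ s x) (θ s x) (u s x)) +
      ∑ l, empiricalMomentumField w (fun x => u s x l / θ s x) l +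
      empiricalEnergyField w (fun x => -(θ s x)⁻¹) := by
  simp only [empiricalDensityField_eq_sum, empiricalMomentumField_eq_sum, empiricalEnergyField_eq_sum,
    PiLp.smul_apply, WithLp.ofLp_sum, Finset.sum_apply, smul_eq_mul, tiltExponent_eq_fields, Finset.sum_add_distrib,
    mul_add, Finset.mul_sum]
  congr 1
  congr 1
  exact Finset.sum_comm

/-- Coordinates of the vector-valued Euler momentum integral: `(∫(χρ)•u)ₗ = ∫χ ρ uₗ` (continuous integrand on `𝕋³`). -/
theorem integral_smul_apply (s : ℝ) {χ : T3 → ℝ} (hχ : Continuous χ) (hρc : Continuous (ρ s))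
    (huc : Continuous (u s)) (l : Fin 3) :
    (∫ x, (χ x * ρ s x) • u s x) l = ∫ x, χ x * ρ s x * u s x l := by
  have hint : Integrable (fun x => (χ x * ρ s x) • u s x) := integrable_of_continuous_T3 ((hχ.mul hρc).smul huc)
  rw [show (∫ x, (χ x * ρ s x) • u s x) l = (EuclideanSpace.proj l : V3 →L[ℝ] ℝ) (∫ x, (χ x * ρ s x) • u s x) from rfl,
    ← ContinuousLinearMap.integral_comp_comm _ hint]
  refine integral_congr_ae (Eventually.of_forall fun x => ?_)
  simp only [EuclideanSpace.coe_proj, PiLp.smul_apply, smul_eq_mul]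

/-- The Euler mean splits accordingly: `m_s = ∫λ₀ρ + ∑ₗ (∫(uₗ/θ)ρ • u)ₗ + ∫(−1/θ)·E`, `E = ρ(|u|²/2 + 3θ/2)`. -/
theorem tiltMean_eq_fields (s : ℝ) (hρc : Continuous (ρ s)) (hθc : Continuous (θ s)) (huc : Continuous (u s))
    (hθ : ∀ x, 0 < θ s x) (hΛ : Continuous fun x => lam0 σ (ρ s x) (θ s x) (u s x)) :
    tiltMean σ ρ θ u s = (∫ x, lam0 σ (ρ s x) (θ s x) (u s x) * ρ s x) +
      ∑ l, (∫ x, (u s x l / θ s x * ρ s x) • u s x) l +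
      ∫ x, -(θ s x)⁻¹ * totalEnergyDensity (ρ s x) (u s x) (θ s x) := by
  have hul : ∀ l, Continuous fun x => u s x l := fun l => (by fun_prop : Continuous fun v : V3 => v l).comp huc
  have hχl : ∀ l, Continuous fun x => u s x l / θ s x := fun l => (hul l).div hθc fun x => (hθ x).ne'
  have hE : Continuous fun x => totalEnergyDensity (ρ s x) (u s x) (θ s x) := by
    simp only [totalEnergyDensity]
    exact hρc.mul (((huc.norm.pow 2).div_const 2).add (continuous_const.mul hθc))
  have hIl : ∀ l, (∫ x, (u s x l / θ s x * ρ s x) • u s x) l = ∫ x, u s x l / θ s x * ρ s x * u s x l := fun l =>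
    integral_smul_apply s (hχl l) hρc huc l
  simp_rw [hIl]
  have hA : Integrable (fun x => lam0 σ (ρ s x) (θ s x) (u s x) * ρ s x) := integrable_of_continuous_T3 (hΛ.mul hρc)
  have hB : ∀ l, Integrable (fun x => u s x l / θ s x * ρ s x * u s x l) := fun l =>
    integrable_of_continuous_T3 (((hχl l).mul hρc).mul (hul l))
  have hC : Integrable (fun x => -(θ s x)⁻¹ * totalEnergyDensity (ρ s x) (u s x) (θ s x)) :=
    integrable_of_continuous_T3 ((hθc.inv₀ fun x => (hθ x).ne').neg.mul hE)
  have hBs : Integrable (fun x => ∑ l, u s x l / θ s x * ρ s x * u s x l) := integrable_finsetSum _ fun l _ => hB l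
  have hAB : Integrable (fun x => lam0 σ (ρ s x) (θ s x) (u s x) * ρ s x + ∑ l, u s x l / θ s x * ρ s x * u s x l) :=
    hA.add hBs
  calc tiltMean σ ρ θ u s = ∫ x, lam0 σ (ρ s x) (θ s x) (u s x) * ρ s x + ∑ l, u s x l / θ s x * ρ s x * u s x l +
        -(θ s x)⁻¹ * totalEnergyDensity (ρ s x) (u s x) (θ s x) := by
        rw [tiltMean]
        refine integral_congr_ae (Eventually.of_forall fun x => ?_)
        have hθx : θ s x ≠ 0 := (hθ x).ne'
        have h1 : ∑ l, u s x l / θ s x * ρ s x * u s x l = ‖u s x‖ ^ 2 * (ρ s x / θ s x) := by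
          rw [EuclideanSpace.real_norm_sq_eq, Finset.sum_mul]
          exact Finset.sum_congr rfl fun l _ => by ring
        simp only [h1, totalEnergyDensity]
        field_simp
        ring
    _ = _ := by rw [integral_add hAB hC, integral_add hA hBs, integral_finsetSum _ fun l _ => hB l]

/-- **The linear statistic is dominated by the five field deviations**: with `χ_ρ = λ₀(s,·)`, `χₗ = uₗ(s,·)/θ(s,·)` and
`χ_E = −1/θ(s,·)`,  `|ℓ_s(w)| ≤ |D_w(χ_ρ) − ∫χ_ρρ_s| + ∑ₗ ‖M_w(χₗ) − ∫(χₗρ_s)•u_s‖ + |E_w(χ_E) − ∫χ_E E_s|`. -/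
theorem abs_linStat_le_fields (s : ℝ) (hρc : Continuous (ρ s)) (hθc : Continuous (θ s)) (huc : Continuous (u s))
    (hθ : ∀ x, 0 < θ s x) (hΛ : Continuous fun x => lam0 σ (ρ s x) (θ s x) (u s x)) {N : ℕ} (w : Cfg N) :
    |linStat σ ρ θ u s w| ≤
      |empiricalDensityField w (fun x => lam0 σ (ρ s x) (θ s x) (u s x)) - ∫ x, lam0 σ (ρ s x) (θ s x) (u s x) * ρ s x| +
      ∑ l, ‖empiricalMomentumField w (fun x => u s x l / θ s x) - ∫ x, (u s x l / θ s x * ρ s x) • u s x‖ +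
      |empiricalEnergyField w (fun x => -(θ s x)⁻¹) -
        ∫ x, -(θ s x)⁻¹ * totalEnergyDensity (ρ s x) (u s x) (θ s x)| := by
  rw [linStat_eq, tiltPot, avg_tiltExponent_eq_fields, tiltMean_eq_fields s hρc hθc huc hθ hΛ]
  set D := empiricalDensityField w (fun x => lam0 σ (ρ s x) (θ s x) (u s x))
  set M := fun l => empiricalMomentumField w (fun x => u s x l / θ s x)
  set E := empiricalEnergyField w (fun x => -(θ s x)⁻¹)
  set ID := ∫ x, lam0 σ (ρ s x) (θ s x) (u s x) * ρ s x
  set IM := fun l => ∫ x, (u s x l / θ s x * ρ s x) • u s x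
  set IE := ∫ x, -(θ s x)⁻¹ * totalEnergyDensity (ρ s x) (u s x) (θ s x)
  have key : D + ∑ l, M l l + E - (ID + ∑ l, IM l l + IE) = (D - ID) + ∑ l, (M l - IM l) l + (E - IE) := by
    simp only [PiLp.sub_apply, Finset.sum_sub_distrib]
    ring
  rw [key]
  calc |(D - ID) + ∑ l, (M l - IM l) l + (E - IE)| ≤ |D - ID| + |∑ l, (M l - IM l) l| + |E - IE| := abs_add_three _ _ _
    _ ≤ |D - ID| + ∑ l, ‖M l - IM l‖ + |E - IE| := by
        gcongr
        refine (Finset.abs_sum_le_sum_abs _ _).trans (Finset.sum_le_sum fun l _ => ?_)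
        rw [← Real.norm_eq_abs]
        exact PiLp.norm_apply_le (M l - IM l) l

/-! ## Convergence in probability of the linear statistic along the flow -/

/-- Splitting of deviation events (`Tendsto` form): if `X_N ≤ Y_N + Z_N` pointwise, `P_N{a < Y_N} → 0` and `P_N{b < Z_N} → 0`, then
`P_N{a + b < X_N} → 0`. -/
theorem tendsto_measure_lt_of_le_add {Ω : ℕ → Type*} [∀ N, MeasurableSpace (Ω N)] {P : (N : ℕ) → Measure (Ω N)}
    {X Y Z : (N : ℕ) → Ω N → ℝ} {a b : ℝ} (h : ∀ N ω, X N ω ≤ Y N ω + Z N ω)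
    (hY : Tendsto (fun N => P N {ω | a < Y N ω}) atTop (𝓝 0))
    (hZ : Tendsto (fun N => P N {ω | b < Z N ω}) atTop (𝓝 0)) :
    Tendsto (fun N => P N {ω | a + b < X N ω}) atTop (𝓝 0) := by
  refine tendsto_of_tendsto_of_tendsto_of_le_of_le tendsto_const_nhds (by simpa using hY.add hZ)
    (fun N => zero_le) (fun N => ?_)
  calc P N {ω | a + b < X N ω} ≤ P N ({ω | a < Y N ω} ∪ {ω | b < Z N ω}) := by
        refine measure_mono fun ω hω => ?_
        simp only [Set.mem_setOf_eq, Set.mem_union] at hω ⊢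
        by_contra hc
        simp only [not_or, not_lt] at hc
        linarith [h N ω, hc.1, hc.2]
    _ ≤ P N {ω | a < Y N ω} + P N {ω | b < Z N ω} := measure_union_le _ _

/-- **Convergence in probability of `ℓ_s ∘ Φ_s`** from the hydrodynamic limit at time `s` (continuous slice fields, `θ > 0`,
continuous density multiplier): `P_N{δ < |ℓ_s(Φ_s z)|} → 0` for every `δ > 0`. -/
theorem tendsto_measure_lt_abs_linStat_flow {a₀ θ₀ : T3 → ℝ} {u₀ : T3 → V3} {Φ : Flows σ} (s : ℝ)
    (hρc : Continuous (ρ s)) (hθc : Continuous (θ s)) (huc : Continuous (u s)) (hθ : ∀ x, 0 < θ s x)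
    (hΛ : Continuous fun x => lam0 σ (ρ s x) (θ s x) (u s x))
    (hH : TendstoHydroFieldsAt (fun N => localGibbsLaw σ a₀ u₀ θ₀ N (Φ N)) Φ ρ u θ s) {δ : ℝ} (hδ : 0 < δ) :
    Tendsto (fun N => localGibbsLaw σ a₀ u₀ θ₀ N (Φ N) {z | δ < |linStat σ ρ θ u s ((Φ N).flow s z)|})
      atTop (𝓝 0) := by
  have hul : ∀ l, Continuous fun x => u s x l := fun l => (by fun_prop : Continuous fun v : V3 => v l).comp huc
  have hχl : ∀ l, Continuous fun x => u s x l / θ s x := fun l => (hul l).div hθc fun x => (hθ x).ne'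
  have hχE : Continuous fun x => -(θ s x)⁻¹ := (hθc.inv₀ fun x => (hθ x).ne').neg
  have hδ' : 0 < δ / 5 := by positivity
  -- the five deviations
  set dD : (N : ℕ) → Cfg N → ℝ := fun N z =>
    |empiricalDensityField ((Φ N).flow s z) (fun x => lam0 σ (ρ s x) (θ s x) (u s x)) -
      ∫ x, lam0 σ (ρ s x) (θ s x) (u s x) * ρ s x| with hdD
  set dM : Fin 3 → (N : ℕ) → Cfg N → ℝ := fun l N z =>
    ‖empiricalMomentumField ((Φ N).flow s z) (fun x => u s x l / θ s x) - ∫ x, (u s x l / θ s x * ρ s x) • u s x‖ with hdM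
  set dE : (N : ℕ) → Cfg N → ℝ := fun N z =>
    |empiricalEnergyField ((Φ N).flow s z) (fun x => -(θ s x)⁻¹) -
      ∫ x, -(θ s x)⁻¹ * totalEnergyDensity (ρ s x) (u s x) (θ s x)| with hdE
  have hD : Tendsto (fun N => localGibbsLaw σ a₀ u₀ θ₀ N (Φ N) {z | δ / 5 < dD N z}) atTop (𝓝 0) := (hH _ hΛ _ hδ').1
  have hM : ∀ l, Tendsto (fun N => localGibbsLaw σ a₀ u₀ θ₀ N (Φ N) {z | δ / 5 < dM l N z}) atTop (𝓝 0) := fun l =>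
    (hH _ (hχl l) _ hδ').2.1
  have hE : Tendsto (fun N => localGibbsLaw σ a₀ u₀ θ₀ N (Φ N) {z | δ / 5 < dE N z}) atTop (𝓝 0) := (hH _ hχE _ hδ').2.2
  -- chain the splittings
  have h4 := tendsto_measure_lt_of_le_add (P := fun N => localGibbsLaw σ a₀ u₀ θ₀ N (Φ N))
    (X := fun N z => dM 2 N z + dE N z) (fun N z => le_rfl) (hM 2) hE
  have h3 := tendsto_measure_lt_of_le_add (P := fun N => localGibbsLaw σ a₀ u₀ θ₀ N (Φ N))
    (X := fun N z => dM 1 N z + (dM 2 N z + dE N z)) (fun N z => le_rfl) (hM 1) h4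
  have h2 := tendsto_measure_lt_of_le_add (P := fun N => localGibbsLaw σ a₀ u₀ θ₀ N (Φ N))
    (X := fun N z => dM 0 N z + (dM 1 N z + (dM 2 N z + dE N z))) (fun N z => le_rfl) (hM 0) h3
  have h1 := tendsto_measure_lt_of_le_add (P := fun N => localGibbsLaw σ a₀ u₀ θ₀ N (Φ N))
    (X := fun N z => |linStat σ ρ θ u s ((Φ N).flow s z)|)
    (Y := dD) (Z := fun N z => dM 0 N z + (dM 1 N z + (dM 2 N z + dE N z))) (fun N z => ?_) hD h2
  · have hδeq : δ = δ / 5 + (δ / 5 + (δ / 5 + (δ / 5 + δ / 5))) := by ring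
    rw [hδeq]
    exact h1
  · have h := abs_linStat_le_fields s hρc hθc huc hθ hΛ ((Φ N).flow s z)
    simp only [Fin.sum_univ_three] at h
    simp only [hdD, hdM, hdE]
    linarith

/-- **The rated input implies convergence in probability**: `LinearHydroRateAt` gives `P_N{δ < |ℓ_s(Φ_s z)|} → 0` for every
`δ > 0` and `s ∈ [0, t]`. -/
theorem tendsto_measure_lt_abs_linStat_flow_of_rate {a₀ θ₀ : T3 → ℝ} {u₀ : T3 → V3} {Φ : Flows σ}
    (hR : LinearHydroRateAt σ a₀ θ₀ u₀ ρ θ u Φ t) {s : ℝ} (hs : s ∈ Icc 0 t) {δ : ℝ} (hδ : 0 < δ) :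
    Tendsto (fun N => localGibbsLaw σ a₀ u₀ θ₀ N (Φ N) {z | δ < |linStat σ ρ θ u s ((Φ N).flow s z)|})
      atTop (𝓝 0) := by
  obtain ⟨b, p, hb, hp, N₀, hN⟩ := hR
  have hT : Tendsto (fun N : ℕ => (N : ℝ) + 1) atTop atTop := tendsto_atTop_add_const_right _ 1 tendsto_natCast_atTop_atTop
  have hbN : ∀ᶠ N : ℕ in atTop, ((N : ℝ) + 1) ^ (-b) ≤ δ :=
    ((tendsto_rpow_neg_atTop hb).comp hT).eventually (ge_mem_nhds hδ)
  have hpN : Tendsto (fun N : ℕ => ENNReal.ofReal (((N : ℝ) + 1) ^ (-p))) atTop (𝓝 0) := by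
    have h := ENNReal.tendsto_ofReal ((tendsto_rpow_neg_atTop hp).comp hT)
    rwa [ENNReal.ofReal_zero] at h
  refine tendsto_of_tendsto_of_tendsto_of_le_of_le' tendsto_const_nhds hpN (Eventually.of_forall fun N => zero_le) ?_
  filter_upwards [hbN, eventually_ge_atTop N₀] with N hNb hNN
  refine (measure_mono fun z hz => ?_).trans (hN N hNN s hs)
  exact lt_of_le_of_lt hNb hz

/-! ## The pointwise exponential-Markov split of the linear statistic (consumed by part 2) -/

/-- For `y ≥ 1` and a level `m < x`: `x ≤ e^{−(y−1)m} e^{y x}` (from `x ≤ eˣ`). -/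
theorem self_le_exp_mul_exp {x y m : ℝ} (hy : 1 ≤ y) (hm : m < x) :
    x ≤ Real.exp (-((y - 1) * m)) * Real.exp (y * x) := by
  have h1 : x ≤ Real.exp x := by linarith [Real.add_one_le_exp x]
  refine h1.trans ?_
  rw [← Real.exp_add, Real.exp_le_exp]
  nlinarith [mul_le_mul_of_nonneg_left hm.le (sub_nonneg.2 hy)]

/-- **Pointwise splitting of `|ℓ_s ∘ Φ_s|`.**  With `|ℓ| ≤ A₁ + D·E/(N+1)`, a level `m ≥ 0` and `κ(N+1) ≥ 1`, for every `z`: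
`|ℓ_s(Φ_s z)| ≤ β + (A₁ + D m)·𝟙{β < |ℓ_s(Φ_s z)|} + D e^{−(κ(N+1)−1)m} e^{κ E(Φ_s z)}`. -/
theorem abs_linStat_flow_le_split {N : ℕ} (Φ : Flow σ N) {s A₁ D κ m β : ℝ} (hD : 0 ≤ D) (hm : 0 ≤ m)
    (hβ0 : 0 ≤ β) (hκN : 1 ≤ κ * ((N : ℝ) + 1))
    (hℓ : ∀ w : Cfg N, |linStat σ ρ θ u s w| ≤ A₁ + D * (configEnergy w / ((N : ℝ) + 1))) (z : Cfg N) :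
    |linStat σ ρ θ u s (Φ.flow s z)| ≤ β +
      (A₁ + D * m) * ({z | β < |linStat σ ρ θ u s (Φ.flow s z)|} : Set (Cfg N)).indicator 1 z +
      D * (Real.exp (-((κ * ((N : ℝ) + 1) - 1) * m)) * Real.exp (κ * configEnergy (Φ.flow s z))) := by
  have hN : (0 : ℝ) < (N : ℝ) + 1 := by positivity
  set X : ℝ := configEnergy (Φ.flow s z) / ((N : ℝ) + 1) with hX
  have hthird : 0 ≤ D * (Real.exp (-((κ * ((N : ℝ) + 1) - 1) * m)) * Real.exp (κ * configEnergy (Φ.flow s z))) := by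
    positivity
  by_cases hb : β < |linStat σ ρ θ u s (Φ.flow s z)|
  · rw [indicator_of_mem (show z ∈ {z | β < |linStat σ ρ θ u s (Φ.flow s z)|} from hb), Pi.one_apply, mul_one]
    have h := hℓ (Φ.flow s z)
    rw [← hX] at h
    by_cases hXm : X ≤ m
    · have : D * X ≤ D * m := mul_le_mul_of_nonneg_left hXm hD
      linarith
    · push Not at hXm
      have hexp := self_le_exp_mul_exp hκN hXm
      have hκX : κ * ((N : ℝ) + 1) * X = κ * configEnergy (Φ.flow s z) := by
        rw [hX]; field_simp
      rw [hκX] at hexp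
      have h3 : D * X ≤ D * (Real.exp (-((κ * ((N : ℝ) + 1) - 1) * m)) * Real.exp (κ * configEnergy (Φ.flow s z))) :=
        mul_le_mul_of_nonneg_left hexp hD
      have hDm : 0 ≤ D * m := mul_nonneg hD hm
      linarith [hb]
  · push Not at hb
    rw [indicator_of_notMem (show z ∉ {z | β < |linStat σ ρ θ u s (Φ.flow s z)|} from not_lt.2 hb), mul_zero, add_zero]
    linarith

end LinStatL1

open LinStatL1 in
/-- **Convergence in probability of the linear statistic along the flow from the hydrodynamic limit at time `s`** (registered
sub-goal `tendsto_measure_linStat_flow_of_hydroFieldsAt` of the crux): for slice fields `ρ(s,·)`, `θ(s,·) > 0`, `u(s,·)` continuous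
and a continuous density multiplier `λ₀(s,·)`, `TendstoHydroFieldsAt … s` implies `P_N{δ < |ℓ_s(Φ_s z)|} → 0` for every `δ > 0`. -/
theorem tendsto_measure_linStat_flow_of_hydroFieldsAt : ∀ (σ : ℝ) (a₀ θ₀ : T3 → ℝ) (u₀ : T3 → V3) (ρ θ : ℝ → T3 → ℝ) (u : ℝ → T3 → V3) (Φ : (N : ℕ) → HardSphereFlow (Torus.geometry (Fin 3)) (hsDiameter σ N) (N + 1)) (s : ℝ), Continuous (ρ s) → Continuous (θ s) → Continuous (u s) → (∀ x, 0 < θ s x) → (Continuous fun x => lam0 σ (ρ s x) (θ s x) (u s x)) → TendstoHydroFieldsAt (fun N => localGibbsLaw σ a₀ u₀ θ₀ N (Φ N)) Φ ρ u θ s → ∀ δ : ℝ, 0 < δ → Tendsto (fun N => localGibbsLaw σ a₀ u₀ θ₀ N (Φ N) {z | δ < |linStat σ ρ θ u s ((Φ N).flow s z)|}) atTop (𝓝 0) := by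
  intro σ a₀ θ₀ u₀ ρ θ u Φ s hρc hθc huc hθ hΛ hH δ hδ
  exact tendsto_measure_lt_abs_linStat_flow s hρc hθc huc hθ hΛ hH hδ

end Summit.AtomisticToContinuum.HydrodynamicLimit.Theorems.FibreDeficitTransfer

end
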